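import Mathlib.Analysis.SpecialFunctions.Exp
import HarnessLib

/-!
# NE7ExpansionRemainderCurvedCurrency — THE CURRENCY CLAUSE OF THE STRONG CURVED EXPANSION LETTER: every term of
# `ρ_W = #Plane·(2c_loc + 64α₀α₁ + 1024xα₀²)` (F65 `NE7ExpansionRemainderCurvedStrong`) is `O(M⁻³)` in the currencies `α₀ ≤ α̂∕M`, `α₁ ≤ α̂₁∕M²`, `x ≤ b̂∕M²`:
# `ρ_W ≤ #Plane·(144α̂α̂₁ + 5760α̂³ + 8α̂₁² + 2304α̂²α̂₁ + 50688α̂⁴ + 2048b̂α̂²)∕M³`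

Cell `pub-balaban`, rung (B)+1 sub-cell t4, lineage `b2b-balaban-t4-ne7-p1` (CRUX PROVER NE7 #1 = OWNER of row NE7), generation 75.  Companion of F65 (split off for the
400-line lint); the curved twin of F48b `NE7ExpansionRemainderFlat.rho_currency` with the two curvature monomials `xα₀²`.  Pure real arithmetic: `e^{α₀} − 1 ≤ 2α₀` for
`α₀ ≤ 1` (`Real.abs_exp_sub_one_le`), and every monomial `α₀^iα₁^jx^k` of the expanded bound has `M`-weight `i + 2j + 2k ≥ 3`.
HONEST FRAMING (page 1): arithmetic; nothing of Bałaban's asserted; (APE) on curved data NOT proved; NOT ONE-STEP, NOT NE7; spine 0∕9; finite T⁴ rung (B)+1 — NOT infinite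
volume, NOT mass gap, NOT `BetaPertH`, NOT Clay.  Continuum YM on T⁴ ⇐ BetaPertH ∧ nine spine estimates (0/9 proved); BetaPertH ⇐ (D1) ∧ (D4) ∧ CAP+tail; G-an2-4
gates asym, D1 and NE2/3/4.
-/

set_option autoImplicit false

namespace Summit.QuantumFields.BalabanUV.T4Continuum.NE7ExpansionRemainderCurvedCurrency

/-! ## §5 The currency: every term of `ρ_W` is `O(M⁻³)` -/

/-- **THE CURRENCY CLAUSE `ρ_W ≤ ρ̂_W∕M³`.**  With `M ≥ 1`, `0 ≤ α₀ ≤ α̂∕M`, `0 ≤ α₁ ≤ α̂₁∕M²`, `0 ≤ x ≤ b̂∕M²`, `α̂ ≤ 1` and any `c_P ≥ 0` (`= #Plane`):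
`ρ_W ≤ c_P·(144α̂α̂₁ + 5760α̂³ + 8α̂₁² + 2304α̂²α̂₁ + 50688α̂⁴ + 2048b̂α̂²)∕M³` — `e^{α₀} − 1 ≤ 2α₀`, and every monomial `α₀^iα₁^jx^k` of the expanded bound has
`M`-weight `i + 2j + 2k ≥ 3` (F48b's `rho_currency` plus the two curvature monomials `xα₀²`). [folklore] -/
theorem rhoW_strong_currency {M α₀ α₁ x αh αh1 bh cP : ℝ} (hM : 1 ≤ M) (hα₀ : 0 ≤ α₀) (hα₀h : α₀ ≤ αh / M) (hα₁ : 0 ≤ α₁) (hα₁h : α₁ ≤ αh1 / M ^ 2)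
    (hx : 0 ≤ x) (hxh : x ≤ bh / M ^ 2) (hαh1 : αh ≤ 1) (hcP : 0 ≤ cP) :
    cP * (2 * (240 * (Real.exp α₀ - 1) * α₀ * (2 * α₁ + 24 * α₀ * (Real.exp α₀ - 1) + x) + 8 * α₀ * (2 * α₁ + 24 * α₀ * (Real.exp α₀ - 1))
              + 6 * (Real.exp α₀ - 1) * (2 * α₁ + 24 * (Real.exp α₀ - 1) * α₀)
              + (2 * α₁ + 24 * (Real.exp α₀ - 1) * α₀) * (2 * α₁ + 24 * α₀ * (Real.exp α₀ - 1))
              + 960 * (Real.exp α₀ - 1) * α₀ ^ 2 + 32 * x * α₀ ^ 2)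
            + (64 * α₀ * α₁ + 1024 * x * α₀ ^ 2))
      ≤ cP * (144 * (αh * αh1) + 5760 * αh ^ 3 + 8 * (αh1 * αh1) + 2304 * (αh1 * αh ^ 2) + 50688 * αh ^ 4 + 2048 * (bh * αh ^ 2)) / M ^ 3 := by
  have hM0 : 0 < M := by linarith
  have hM2 : 0 < M ^ 2 := by positivity
  have hM3 : 0 < M ^ 3 := by positivity
  have ha : α₀ * M ≤ αh := by rwa [le_div_iff₀ hM0] at hα₀h
  have hb : α₁ * M ^ 2 ≤ αh1 := by rwa [le_div_iff₀ hM2] at hα₁h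
  have hxb : x * M ^ 2 ≤ bh := by rwa [le_div_iff₀ hM2] at hxh
  have hαh0 : 0 ≤ αh := le_trans (by positivity) ha
  have hαh10 : 0 ≤ αh1 := le_trans (by positivity) hb
  have hbh0 : 0 ≤ bh := le_trans (by positivity) hxb
  have hα₀1 : α₀ ≤ 1 := by
    have h1 : α₀ ≤ α₀ * M := by nlinarith
    linarith
  -- Step 1: replace `δ = e^{α₀} − 1` by `2α₀`
  set δ : ℝ := Real.exp α₀ - 1 with hδdef
  have hδ0 : 0 ≤ δ := by rw [hδdef]; linarith [Real.one_le_exp hα₀]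
  have hδ : δ ≤ 2 * α₀ := by
    have h := Real.abs_exp_sub_one_le (x := α₀) (by rwa [abs_of_nonneg hα₀])
    rw [abs_of_nonneg hα₀] at h
    exact (le_abs_self _).trans h
  have step1 : 2 * (240 * δ * α₀ * (2 * α₁ + 24 * α₀ * δ + x) + 8 * α₀ * (2 * α₁ + 24 * α₀ * δ)
              + 6 * δ * (2 * α₁ + 24 * δ * α₀) + (2 * α₁ + 24 * δ * α₀) * (2 * α₁ + 24 * α₀ * δ) + 960 * δ * α₀ ^ 2 + 32 * x * α₀ ^ 2)
            + (64 * α₀ * α₁ + 1024 * x * α₀ ^ 2)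
      ≤ 144 * (α₀ * α₁) + 5760 * α₀ ^ 3 + 8 * (α₁ * α₁) + 2304 * (α₁ * α₀ ^ 2) + 50688 * α₀ ^ 4 + 2048 * (x * α₀ ^ 2) := by
    have i1 : 2 * α₁ + 24 * δ * α₀ ≤ 2 * α₁ + 48 * α₀ * α₀ := by
      have h24 : 24 * δ * α₀ ≤ 24 * (2 * α₀) * α₀ := mul_le_mul_of_nonneg_right (mul_le_mul_of_nonneg_left hδ (by norm_num)) hα₀
      linarith
    have i1' : 2 * α₁ + 24 * α₀ * δ ≤ 2 * α₁ + 48 * α₀ * α₀ := by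
      have h24 : 24 * α₀ * δ ≤ 24 * α₀ * (2 * α₀) := mul_le_mul_of_nonneg_left hδ (by positivity)
      linarith
    have i0 : 0 ≤ 2 * α₁ + 24 * δ * α₀ := by positivity
    have i0' : 0 ≤ 2 * α₁ + 24 * α₀ * δ := by positivity
    have j1 : 0 ≤ 2 * α₁ + 48 * α₀ * α₀ := by positivity
    have e0 : 240 * δ * α₀ * (2 * α₁ + 24 * α₀ * δ + x) ≤ 480 * α₀ * α₀ * (2 * α₁ + 48 * α₀ * α₀ + x) := by
      have h1 : 240 * δ * α₀ ≤ 240 * (2 * α₀) * α₀ := mul_le_mul_of_nonneg_right (mul_le_mul_of_nonneg_left hδ (by norm_num)) hα₀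
      have h2 : 2 * α₁ + 24 * α₀ * δ + x ≤ 2 * α₁ + 48 * α₀ * α₀ + x := by linarith
      have h3 : 0 ≤ 2 * α₁ + 24 * α₀ * δ + x := by positivity
      calc 240 * δ * α₀ * (2 * α₁ + 24 * α₀ * δ + x) ≤ 240 * (2 * α₀) * α₀ * (2 * α₁ + 48 * α₀ * α₀ + x) := mul_le_mul h1 h2 h3 (by positivity)
        _ = 480 * α₀ * α₀ * (2 * α₁ + 48 * α₀ * α₀ + x) := by ring
    have e1 : 8 * α₀ * (2 * α₁ + 24 * α₀ * δ) ≤ 8 * α₀ * (2 * α₁ + 48 * α₀ * α₀) := mul_le_mul_of_nonneg_left i1' (by positivity)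
    have e2 : 6 * δ * (2 * α₁ + 24 * δ * α₀) ≤ 12 * α₀ * (2 * α₁ + 48 * α₀ * α₀) := by
      have h6 : 6 * δ ≤ 6 * (2 * α₀) := mul_le_mul_of_nonneg_left hδ (by norm_num)
      calc 6 * δ * (2 * α₁ + 24 * δ * α₀) ≤ 6 * (2 * α₀) * (2 * α₁ + 48 * α₀ * α₀) := mul_le_mul h6 i1 i0 (by positivity)
        _ = 12 * α₀ * (2 * α₁ + 48 * α₀ * α₀) := by ring
    have e3 : (2 * α₁ + 24 * δ * α₀) * (2 * α₁ + 24 * α₀ * δ) ≤ (2 * α₁ + 48 * α₀ * α₀) * (2 * α₁ + 48 * α₀ * α₀) :=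
      mul_le_mul i1 i1' i0' j1
    have e4 : 960 * δ * α₀ ^ 2 ≤ 1920 * α₀ * α₀ ^ 2 := by
      have h960 : 960 * δ * α₀ ^ 2 ≤ 960 * (2 * α₀) * α₀ ^ 2 := mul_le_mul_of_nonneg_right (mul_le_mul_of_nonneg_left hδ (by norm_num)) (sq_nonneg α₀)
      linarith
    have expand : 2 * (480 * α₀ * α₀ * (2 * α₁ + 48 * α₀ * α₀ + x) + 8 * α₀ * (2 * α₁ + 48 * α₀ * α₀)
              + 12 * α₀ * (2 * α₁ + 48 * α₀ * α₀) + (2 * α₁ + 48 * α₀ * α₀) * (2 * α₁ + 48 * α₀ * α₀) + 1920 * α₀ * α₀ ^ 2 + 32 * x * α₀ ^ 2)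
            + (64 * α₀ * α₁ + 1024 * x * α₀ ^ 2)
        = 144 * (α₀ * α₁) + 5760 * α₀ ^ 3 + 8 * (α₁ * α₁) + 2304 * (α₁ * α₀ ^ 2) + 50688 * α₀ ^ 4 + 2048 * (x * α₀ ^ 2) := by ring
    linarith
  -- Step 2: the monomials against `M³`
  have m01 : α₀ * α₁ * M ^ 3 ≤ αh * αh1 := by
    have : α₀ * α₁ * M ^ 3 = (α₀ * M) * (α₁ * M ^ 2) := by ring
    rw [this]; exact mul_le_mul ha hb (by positivity) hαh0
  have m03 : α₀ ^ 3 * M ^ 3 ≤ αh ^ 3 := by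
    have : α₀ ^ 3 * M ^ 3 = (α₀ * M) ^ 3 := by ring
    rw [this]; exact pow_le_pow_left₀ (by positivity) ha 3
  have hM34 : M ^ 3 ≤ M ^ 4 := pow_le_pow_right₀ hM (by norm_num)
  have m11 : α₁ * α₁ * M ^ 3 ≤ αh1 * αh1 := by
    have h4 : α₁ * α₁ * M ^ 4 ≤ αh1 * αh1 := by
      have : α₁ * α₁ * M ^ 4 = (α₁ * M ^ 2) * (α₁ * M ^ 2) := by ring
      rw [this]; exact mul_le_mul hb hb (by positivity) hαh10
    exact (mul_le_mul_of_nonneg_left hM34 (by positivity)).trans h4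
  have m12 : α₁ * α₀ ^ 2 * M ^ 3 ≤ αh1 * αh ^ 2 := by
    have h4 : α₁ * α₀ ^ 2 * M ^ 4 ≤ αh1 * αh ^ 2 := by
      have : α₁ * α₀ ^ 2 * M ^ 4 = (α₁ * M ^ 2) * (α₀ * M) ^ 2 := by ring
      rw [this]; exact mul_le_mul hb (pow_le_pow_left₀ (by positivity) ha 2) (by positivity) hαh10
    exact (mul_le_mul_of_nonneg_left hM34 (by positivity)).trans h4
  have m04 : α₀ ^ 4 * M ^ 3 ≤ αh ^ 4 := by
    have h4 : α₀ ^ 4 * M ^ 4 ≤ αh ^ 4 := by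
      have : α₀ ^ 4 * M ^ 4 = (α₀ * M) ^ 4 := by ring
      rw [this]; exact pow_le_pow_left₀ (by positivity) ha 4
    exact (mul_le_mul_of_nonneg_left hM34 (by positivity)).trans h4
  have mx2 : x * α₀ ^ 2 * M ^ 3 ≤ bh * αh ^ 2 := by
    have h4 : x * α₀ ^ 2 * M ^ 4 ≤ bh * αh ^ 2 := by
      have : x * α₀ ^ 2 * M ^ 4 = (x * M ^ 2) * (α₀ * M) ^ 2 := by ring
      rw [this]; exact mul_le_mul hxb (pow_le_pow_left₀ (by positivity) ha 2) (by positivity) hbh0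
    exact (mul_le_mul_of_nonneg_left hM34 (by positivity)).trans h4
  have key : (144 * (α₀ * α₁) + 5760 * α₀ ^ 3 + 8 * (α₁ * α₁) + 2304 * (α₁ * α₀ ^ 2) + 50688 * α₀ ^ 4 + 2048 * (x * α₀ ^ 2)) * M ^ 3
      ≤ 144 * (αh * αh1) + 5760 * αh ^ 3 + 8 * (αh1 * αh1) + 2304 * (αh1 * αh ^ 2) + 50688 * αh ^ 4 + 2048 * (bh * αh ^ 2) := by
    have expand : (144 * (α₀ * α₁) + 5760 * α₀ ^ 3 + 8 * (α₁ * α₁) + 2304 * (α₁ * α₀ ^ 2) + 50688 * α₀ ^ 4 + 2048 * (x * α₀ ^ 2)) * M ^ 3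
        = 144 * (α₀ * α₁ * M ^ 3) + 5760 * (α₀ ^ 3 * M ^ 3) + 8 * (α₁ * α₁ * M ^ 3) + 2304 * (α₁ * α₀ ^ 2 * M ^ 3)
          + 50688 * (α₀ ^ 4 * M ^ 3) + 2048 * (x * α₀ ^ 2 * M ^ 3) := by ring
    rw [expand]
    linarith
  rw [le_div_iff₀ hM3]
  calc cP * (2 * (240 * δ * α₀ * (2 * α₁ + 24 * α₀ * δ + x) + 8 * α₀ * (2 * α₁ + 24 * α₀ * δ)
              + 6 * δ * (2 * α₁ + 24 * δ * α₀) + (2 * α₁ + 24 * δ * α₀) * (2 * α₁ + 24 * α₀ * δ) + 960 * δ * α₀ ^ 2 + 32 * x * α₀ ^ 2)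
            + (64 * α₀ * α₁ + 1024 * x * α₀ ^ 2)) * M ^ 3
      ≤ cP * (144 * (α₀ * α₁) + 5760 * α₀ ^ 3 + 8 * (α₁ * α₁) + 2304 * (α₁ * α₀ ^ 2) + 50688 * α₀ ^ 4 + 2048 * (x * α₀ ^ 2)) * M ^ 3 :=
        mul_le_mul_of_nonneg_right (mul_le_mul_of_nonneg_left step1 hcP) hM3.le
    _ = cP * ((144 * (α₀ * α₁) + 5760 * α₀ ^ 3 + 8 * (α₁ * α₁) + 2304 * (α₁ * α₀ ^ 2) + 50688 * α₀ ^ 4 + 2048 * (x * α₀ ^ 2)) * M ^ 3) := by ring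
    _ ≤ cP * (144 * (αh * αh1) + 5760 * αh ^ 3 + 8 * (αh1 * αh1) + 2304 * (αh1 * αh ^ 2) + 50688 * αh ^ 4 + 2048 * (bh * αh ^ 2)) :=
        mul_le_mul_of_nonneg_left key hcP

end Summit.QuantumFields.BalabanUV.T4Continuum.NE7ExpansionRemainderCurvedCurrency
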